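import Mathlib
import Summits.KontsevichZagierPeriods.Zeta5Search.DenomLaw.ABFamilyFPArith
import Summits.KontsevichZagierPeriods.Zeta5Search.DenomLaw.RuleRABTopCellHolds
import Summits.KontsevichZagierPeriods.Zeta5Search.DenomLaw.PathAccountingShallow
import Summits.KontsevichZagierPeriods.Zeta5Search.DenomLaw.TS3RayPath
import HarnessLib

/-!
# ζ(5) search — PATH ACCOUNTING on the WHOLE first period of the A/B linear family `n·(3t+14; t+6,…,t)` (census A14, A15, A16, A18, B20, X3), ALL `t ≥ 8`, ALL `n`

Cell `pub-zeta5` (HONEST FRAMING: systematic search; no irrationality claim unless certified), TRACK «DENOM-LAW» D1 prover seat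
(denom-prover-d1 g16, `HOME/denom-law/prover-d1/ATTEMPT-16.md` §7).  The typed D2 node `DenomLaw.PathAccountingFirstPeriod` (Brown–Zudilin (28)+(30)
transported by `G ≅ S₇`, Casoratian form) is proved on the A/B linear family `bLin (t n) (t n + 2n) n = n·(3t+14; t+6, t+5, …, t)` — the dual rays of the
census's A/B directions `a_k = (k, k+2, k+2, k+1, k+4, k+8, k+10, k+5)`, `t = k − 3` (A14, A15, A16, A18, B20 and X3: `t = 11, 12, 13, 15, 17, 14`; the rays
carrying engine-d2's rule R) — for EVERY `t ≥ 8`, EVERY `n ≥ 1` and EVERY first-period prime (`2p > (t+13)n`), direction `j = 7`: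
* the DEEP cells `p ≤ (t+2)n` (all 21 blocks reach `p`) by THEOREM L5 / A⁗′ in the frame `(10, [1,−6,−6,1])` (`ABFamilyFPCasLB.cas_ge_e3/e2`) — the SAME
  frame as the TOP family's (`DenomLaw/TopFamilyFPDeep`);
* the rule-R2 strip `(t+2)n < p ≤ (t+7)n` by gen 2/3's `RuleRAB.ruleR2_strip` (values `−13,−13,−13,−12,−11`, the first = engine-d2's rule-R2 cell, proved by the
  conjugate-raise law) with `C⋆ ≤ 10, 9, 8, 7, 6`;
* `(t+7)n < p ≤ (t+13)n` by THEOREM LB on the covers `ABFamilyFPCellsA–C` (`casLB = −9, −7, −5, −3, −1, 0`) with `C⋆ ≤ 6, 5, 4, 3`;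
* `p > (t+13)n` by g6's shallow kit.
integer data in `DenomLaw/ABFamilyFPArith`; §2 `pathAccounting_ab`; §3 **`pathAccountingFirstPeriod_on_ab` — the node with
`b := bLin (t n) (t n + 2n) n`, binders VERBATIM, every `t ≥ 8`, every `n ≥ 1`** (so on A14–A18, B20, X3 for all `n`), and the (CV) corollary.
MODEL/structure-side valuation bookkeeping of the cell's own rationals; nothing about ζ(5); no γ; records in print UNMOVED.
-/

open Finset

namespace Summit.KontsevichZagierPeriods.Zeta5Search.ABFamFP

open Summit.KontsevichZagierPeriods.Zeta5Search.ClusterValuation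
open Summit.KontsevichZagierPeriods.Zeta5Search.CasoratianValuation (InPolytope shift casoratian pairFloors refund)
open Summit.KontsevichZagierPeriods.Zeta5Search.WedgeDictionary (dOf)
open Summit.KontsevichZagierPeriods.Zeta5Search.ClassTypeCover
open Summit.KontsevichZagierPeriods.Zeta5Search.CellKit
open Summit.KontsevichZagierPeriods.Zeta5Search.RuleRAB (ab_zero dOf_ab inPolytope_ab inPolytope_shift_ab ruleR2_strip)
open Summit.KontsevichZagierPeriods.Zeta5Search.DenomLaw (cStar FirstPeriod Sorted7 BlockGe)
open Summit.KontsevichZagierPeriods.Zeta5Search.DenomLaw.FirstPeriodKit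
  (cStar_le_eleven shallow_pairs pairFloors_eq_zero_of_shallow noMultipole_of_shallow cStar_le_of_shallow)
open Summit.KontsevichZagierPeriods.Zeta5Search.StairTS3 (refund_le_pathHead)


/-! ## §2 The assembly -/

/-- The node's left side is at most `3 − N − (5 − K)` when `2 ≤ ⌊d/p⌋ ≤ 3` and `C⋆ ≤ K`, `K ≥ 4`. -/
theorem head_le {d N C K : ℤ} (h2 : 2 ≤ d) (h3 : d ≤ 3) (hC : C ≤ K) (hK : 4 ≤ K) :
    d - N - min (if 2 ≤ d then (1 : ℤ) else 0) (5 - C) ≤ 3 - N - (5 - K) := by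
  rw [if_pos h2]
  have : 5 - K ≤ min (1 : ℤ) (5 - C) := le_min (by linarith) (by linarith)
  linarith

/-- **`PathAccountingFirstPeriod`'s conclusion on the WHOLE first period of the A/B family**, direction `7`, all `t ≥ 8`, all `n ≥ 1`. -/
theorem pathAccounting_ab (t n p : ℕ) (ht : 8 ≤ t) (hn : 1 ≤ n) (hprime : p.Prime) (hF : t * n + 13 * n < 2 * p)
    (hcas : casoratian (bLin (t * n) (t * n + 2 * n) n) 7 ≠ 0) :
    dOf (bLin (t * n) (t * n + 2 * n) n) / (p : ℤ) - pairFloors (bLin (t * n) (t * n + 2 * n) n) p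
        - min (if 2 ≤ dOf (bLin (t * n) (t * n + 2 * n) n) / (p : ℤ) then (1 : ℤ) else 0) (5 - (cStar (bLin (t * n) (t * n + 2 * n) n) p : ℤ))
      ≤ padicValRat p (casoratian (bLin (t * n) (t * n + 2 * n) n) 7) := by
  haveI : Fact p.Prime := ⟨hprime⟩
  have htn : 8 * n ≤ t * n := Nat.mul_le_mul_right n ht
  have hp2 : p % 2 = 1 := Nat.odd_iff.1 (hprime.odd_of_ne_two (by omega))
  have hLB := cas_ge_casLB htn hn hprime hF hcas
  have hC11 : (cStar (bLin (t * n) (t * n + 2 * n) n) p : ℤ) ≤ 11 := by exact_mod_cast cStar_le_eleven _ p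
  have h3 := dOf_ab_div_le_three (t := t) (n := n) (p := p) hF
  obtain ⟨s1, s2, s3, s4, s5⟩ := ruleR2_strip t n p ht hn hprime hcas
  -- p ≤ (t+7)n : 2 ≤ ⌊d/p⌋ ≤ 3
  by_cases h7 : p ≤ t * n + 7 * n
  · have h2 := dOf_ab_div_ge_two (t := t) (n := n) (p := p) (by omega) hprime.pos
    by_cases hd : p ≤ t * n + 2 * n
    · -- deep cells
      rw [N_le3 (by omega) hF]
      have hmin : -6 ≤ min (1 : ℤ) (5 - (cStar (bLin (t * n) (t * n + 2 * n) n) p : ℤ)) := le_min (by norm_num) (by linarith)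
      rw [if_pos h2]
      by_cases hf3 : 3 * p ≤ 2 * (t * n) + 21 * n
      · linarith [cas_ge_e3 htn hn hprime hF hf3 hd hcas]
      · push Not at hf3
        rw [dOf_ab_div_two hf3 (by omega)]
        linarith [cas_ge_e2 hn hprime hf3 hd hF hcas]
    by_cases hc2 : p ≤ t * n + 3 * n
    · rw [N_le3 hc2 hF]
      have hK : (cStar (bLin (t * n) (t * n + 2 * n) n) p : ℤ) ≤ 10 := by exact_mod_cast cStar_ab_le_ten (t := t) (n := n) (p := p) (by omega)
      have hh := head_le (N := (21 : ℤ)) h2 h3 hK (by norm_num)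
      linarith [s1 (by omega) hc2]
    by_cases hc3 : p ≤ t * n + 4 * n
    · rw [N_a3 (by omega) hc3 hF]
      have hK : (cStar (bLin (t * n) (t * n + 2 * n) n) p : ℤ) ≤ 9 := by exact_mod_cast cStar_ab_le_nine (t := t) (n := n) (p := p) (by omega)
      have hh := head_le (N := (20 : ℤ)) h2 h3 hK (by norm_num)
      linarith [s2 (by omega) hc3]
    by_cases hc4 : p ≤ t * n + 5 * n
    · rw [N_a4 (by omega) hc4 hF]
      have hK : (cStar (bLin (t * n) (t * n + 2 * n) n) p : ℤ) ≤ 8 := by exact_mod_cast cStar_ab_le_eight (t := t) (n := n) (p := p) (by omega)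
      have hh := head_le (N := (19 : ℤ)) h2 h3 hK (by norm_num)
      linarith [s3 (by omega) hc4]
    by_cases hc5 : p ≤ t * n + 6 * n
    · rw [N_a5 (by omega) hc5 hF]
      have hK : (cStar (bLin (t * n) (t * n + 2 * n) n) p : ℤ) ≤ 7 := by exact_mod_cast cStar_ab_le_seven (t := t) (n := n) (p := p) (by omega)
      have hh := head_le (N := (17 : ℤ)) h2 h3 hK (by norm_num)
      linarith [s4 (by omega) hc5]
    · rw [N_a6 (by omega) h7 hF]
      have hK : (cStar (bLin (t * n) (t * n + 2 * n) n) p : ℤ) ≤ 6 := by exact_mod_cast cStar_ab_le_six (t := t) (n := n) (p := p) (by omega)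
      have hh := head_le (N := (15 : ℤ)) h2 h3 hK (by norm_num)
      linarith [s5 (by omega) h7]
  push Not at h7
  -- (t+7)n < p, 2p ≤ d : ⌊d/p⌋ = 2
  by_cases hfd2 : 2 * p ≤ 2 * (t * n) + 21 * n
  · rw [dOf_ab_div_two (by omega) hfd2, if_pos (le_refl _)]
    have hK6 : (cStar (bLin (t * n) (t * n + 2 * n) n) p : ℤ) ≤ 6 := by exact_mod_cast cStar_ab_le_six (t := t) (n := n) (p := p) (by omega)
    have hmin6 : -1 ≤ min (1 : ℤ) (5 - (cStar (bLin (t * n) (t * n + 2 * n) n) p : ℤ)) := le_min (by norm_num) (by linarith)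
    by_cases h : p ≤ t * n + 8 * n
    · rw [N_a7 h7 h hF]
      linarith [casLB_a7 (t := t) (n := n) (p := p) htn hn h7 h hp2]
    have hK5 : (cStar (bLin (t * n) (t * n + 2 * n) n) p : ℤ) ≤ 5 := by exact_mod_cast cStar_ab_le_five (t := t) (n := n) (p := p) (by omega)
    have hmin5 : 0 ≤ min (1 : ℤ) (5 - (cStar (bLin (t * n) (t * n + 2 * n) n) p : ℤ)) := le_min (by norm_num) (by linarith)
    by_cases h' : p ≤ t * n + 9 * n
    · rw [N_a8 (by omega) h' hF]
      linarith [casLB_a8 (t := t) (n := n) (p := p) htn hn (by omega) h' hp2]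
    have hK4 : (cStar (bLin (t * n) (t * n + 2 * n) n) p : ℤ) ≤ 4 := by exact_mod_cast cStar_ab_le_four (t := t) (n := n) (p := p) (by omega)
    have hmin4 : 1 ≤ min (1 : ℤ) (5 - (cStar (bLin (t * n) (t * n + 2 * n) n) p : ℤ)) := le_min le_rfl (by linarith)
    by_cases h : p ≤ t * n + 10 * n
    · rw [N_a9 (by omega) h hF]
      linarith [casLB_a9 (t := t) (n := n) (p := p) htn hn (by omega) h hp2]
    · rw [N_a10 (by omega) (by omega) hF]
      linarith [casLB_a10 (t := t) (n := n) (p := p) htn hn (by omega) (by omega) hp2]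
  push Not at hfd2
  -- ⌊d/p⌋ = 1 up to (t+13)n
  by_cases h13 : p ≤ t * n + 13 * n
  · rw [dOf_ab_div_one hfd2 (by omega), if_neg (by norm_num)]
    have hK3 : (cStar (bLin (t * n) (t * n + 2 * n) n) p : ℤ) ≤ 3 := by exact_mod_cast cStar_ab_le_three (t := t) (n := n) (p := p) (by omega)
    have hmin0 : (0 : ℤ) ≤ min (0 : ℤ) (5 - (cStar (bLin (t * n) (t * n + 2 * n) n) p : ℤ)) := le_min le_rfl (by linarith)
    by_cases h : p ≤ t * n + 11 * n
    · rw [N_a10 (by omega) h hF]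
      linarith [casLB_a10 (t := t) (n := n) (p := p) htn hn (by omega) h hp2]
    by_cases h' : p ≤ t * n + 12 * n
    · rw [N_a11 (by omega) h' hF]
      linarith [casLB_a11 (t := t) (n := n) (p := p) htn hn (by omega) h' hp2]
    · rw [N_a12 (by omega) h13 hF]
      linarith [casLB_a12 (t := t) (n := n) (p := p) htn hn (by omega) h13 hp2]
  push Not at h13
  -- beyond (t+13)n: the shallow kit and (CV) without multipoles
  obtain ⟨hp5, hwin⟩ := window_ab htn hn hF
  have hb := inPolytope_ab t n
  have hs := sorted7_ab t n
  have h67 := not_blockGe67_ab h13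
  have hcv := ClusterValuation.casoratianLaw_of_noMultipole _ hb (by norm_num) le_rfl (inPolytope_shift_ab t hn) hp5 hwin
    (noMultipole_of_shallow hb hs hp5 h67) hcas
  have hN := pairFloors_eq_zero_of_shallow hb hs h67
  have hC : (cStar (bLin (t * n) (t * n + 2 * n) n) p : ℤ) ≤ 5 := by exact_mod_cast (cStar_le_of_shallow (shallow_pairs hs h67)).2
  have hd1 := dOf_ab_div_le_one (t := t) (n := n) (p := p) (by omega)
  have hd0 := dOf_ab_div_nonneg (t := t) (n := n) (p := p)
  rw [hN, if_neg (by omega), min_eq_left (by linarith)]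
  unfold refund at hcv
  rw [hN, min_eq_right hd1] at hcv
  linarith

/-! ## §3 The node verbatim -/

/-- On the family the node's hypothesis `FirstPeriod` forces `(t+13)n < 2p` (the pair block `b₀ − b₆ − b₇ = (t+13)n` is `< 2p`). -/
theorem fp_bound_of_firstPeriod_ab {t n p : ℕ} (h : FirstPeriod (bLin (t * n) (t * n + 2 * n) n) p) : t * n + 13 * n < 2 * p := by
  have := h.2 5 (by simp) 6 (by simp) (by norm_num)
  simp only [Nat.reduceAdd, v0, v6, v7] at this
  have h' : ((t * n + 13 * n : ℕ) : ℤ) < 2 * p := by push_cast; linarith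
  exact_mod_cast h'

/-- **The node `PathAccountingFirstPeriod` restricted to the A/B family, EVERY `t ≥ 8`, literally** (all its binders, `b := bLin (t n) (t n + 2n) n`),
all `n ≥ 1` — Brown–Zudilin's prime-by-prime accounting on the whole first period of the census directions A14, A15, A16, A18, B20, X3
(`t = 11, 12, 13, 15, 17, 14`) and of every other direction `(k, k+2, k+2, k+1, k+4, k+8, k+10, k+5)`, `k ≥ 11`, for all `n`. -/
theorem pathAccountingFirstPeriod_on_ab (t : ℕ) (ht : 8 ≤ t) (n p : ℕ) (hn : 1 ≤ n) :
    InPolytope (bLin (t * n) (t * n + 2 * n) n) → Sorted7 (bLin (t * n) (t * n + 2 * n) n) →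
    InPolytope (shift (bLin (t * n) (t * n + 2 * n) n) 7) → p.Prime → 5 ≤ p →
    (bLin (t * n) (t * n + 2 * n) n 0 + 2 : ℤ) < (p : ℤ) ^ 2 → FirstPeriod (bLin (t * n) (t * n + 2 * n) n) p →
    casoratian (bLin (t * n) (t * n + 2 * n) n) 7 ≠ 0 →
      dOf (bLin (t * n) (t * n + 2 * n) n) / (p : ℤ) - pairFloors (bLin (t * n) (t * n + 2 * n) n) p
          - min (if 2 ≤ dOf (bLin (t * n) (t * n + 2 * n) n) / (p : ℤ) then (1 : ℤ) else 0) (5 - (cStar (bLin (t * n) (t * n + 2 * n) n) p : ℤ))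
        ≤ padicValRat p (casoratian (bLin (t * n) (t * n + 2 * n) n) 7) :=
  fun _ _ _ hprime _ _ hfp hcas => pathAccounting_ab t n p ht hn hprime (fp_bound_of_firstPeriod_ab hfp) hcas

/-- **A18** (`a = (18,20,20,19,22,26,28,23)`, the census's second direction; dual ray `n·(59; 21,…,15)`, `t = 15`): the node for every `n ≥ 1`. -/
theorem pathAccountingFirstPeriod_on_a18 (n p : ℕ) (hn : 1 ≤ n) :
    InPolytope (bLin (15 * n) (15 * n + 2 * n) n) → Sorted7 (bLin (15 * n) (15 * n + 2 * n) n) →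
    InPolytope (shift (bLin (15 * n) (15 * n + 2 * n) n) 7) → p.Prime → 5 ≤ p →
    (bLin (15 * n) (15 * n + 2 * n) n 0 + 2 : ℤ) < (p : ℤ) ^ 2 → FirstPeriod (bLin (15 * n) (15 * n + 2 * n) n) p →
    casoratian (bLin (15 * n) (15 * n + 2 * n) n) 7 ≠ 0 →
      dOf (bLin (15 * n) (15 * n + 2 * n) n) / (p : ℤ) - pairFloors (bLin (15 * n) (15 * n + 2 * n) n) p
          - min (if 2 ≤ dOf (bLin (15 * n) (15 * n + 2 * n) n) / (p : ℤ) then (1 : ℤ) else 0) (5 - (cStar (bLin (15 * n) (15 * n + 2 * n) n) p : ℤ))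
        ≤ padicValRat p (casoratian (bLin (15 * n) (15 * n + 2 * n) n) 7) :=
  pathAccountingFirstPeriod_on_ab 15 (by norm_num) n p hn

/-- **(CV) on the whole first-period A/B family, direction 7, all `t ≥ 8`, all `n`** (the (CV) value never exceeds the PATH value). -/
theorem abRayCV_firstPeriod (t n p : ℕ) (ht : 8 ≤ t) (hn : 1 ≤ n) (hprime : p.Prime) (hF : t * n + 13 * n < 2 * p)
    (hcas : casoratian (bLin (t * n) (t * n + 2 * n) n) 7 ≠ 0) :
    refund (bLin (t * n) (t * n + 2 * n) n) p - pairFloors (bLin (t * n) (t * n + 2 * n) n) p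
      ≤ padicValRat p (casoratian (bLin (t * n) (t * n + 2 * n) n) 7) := by
  linarith [refund_le_pathHead (bLin (t * n) (t * n + 2 * n) n) p (5 - (cStar (bLin (t * n) (t * n + 2 * n) n) p : ℤ)),
    pathAccounting_ab t n p ht hn hprime hF hcas]

end Summit.KontsevichZagierPeriods.Zeta5Search.ABFamFP
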